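import Summits.NavierStokesRegularity.OSWSelfSimilar.SheetREvenTests
import HarnessLib

/-!
# SHEET-ℝ frame, EVEN ZERO-MASS class `E⁺₀` — dictionary layer 1b: the normalised even bump, the codimension-one decomposition of the
# even tests, the cutoff tests `χ_R u`, `χ_R² u` of an EVEN profile, and the masses of the cutoffs

HONEST FRAMING (cell ns-blowup GROUP B / zone Z3, case Z3-SR-SPEC EVEN half; 1-D MODEL certificate frame (viscous gCLM/OSW sheet on the
line); not Euler/NS; «violates: none — MODEL»).  Nothing here asserts that a profile exists; no number of record moves.
Companion of `SheetREvenTests` (parity-free / even tests, `testSpaceE`, `testSpaceE0`):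

* the normalised even BUMP `bumpFun = χ₁/∫χ₁` (`χ₁ = cutoff 1`; `∫χ₁ ≥ 2 > 0`): an even test (`isCompactTestE_bump`) of mass `1`;
* `sub_mass_smul_bump_mem` — `v − (∫v)·ρ ∈ testSpaceE0` for every even test, and `eq_mass_mul_of_vanishes` — a linear functional on
  `testSpaceE` vanishing on the zero-mass tests is `(∫v)·Λ(ρ)`: the DEFECT-CONSTANT device of DESIGN-Z3-SR-SPEC-EVEN (PO-1) (a weak equation
  tested on zero-mass even tests holds on ALL even tests modulo `c·∫φ`);
* `isCompactTestE_cutoff_mul` / `_sq_mul` — for `u` EVEN in primitive form with `u, u₁ ∈ L²`, `χ_R u` and `χ_R² u` are even tests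
  (twins of `SheetRLinearisedTests.isCompactTest_cutoff_mul` / `_sq_mul`);
* `tendsto_integral_cutoff_mul` / `_sq_mul` — `∫ χ_{n+1} u → ∫ u`, `∫ χ_{n+1}² u → ∫ u` for `u ∈ L¹` (dominated convergence): for a
  ZERO-MASS profile the masses of its cutoff tests tend to `0`, which is what kills the defect term in the even cutoff arguments.
One definition pair (`bumpFun`/`bumpDeriv`, and `bump` as an element of `testSpaceE`); no named fact.  WHAT THIS IS NOT: not NS.
-/

noncomputable section

namespace Summit.NavierStokesRegularity.OSWSelfSimilar
namespace SheetREvenTests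

open _root_.MeasureTheory _root_.Set _root_.Filter _root_.Real SheetRWeakProfilePV SheetRWeakToStrong SheetREnergyClass SheetRWeightedMeasure
  SheetRLinearisedTests SheetREnergySpace SheetRTestSpace SheetRLinearisedFormBounds
open scoped Topology ENNReal

/-! ### §4 The normalised even bump and the codimension-one decomposition -/

/-- The unit cutoff is integrable. [folklore] -/
theorem integrable_cutoff_one : Integrable (cutoff 1) := by
  refine (contDiff_cutoff 1).continuous.integrable_of_hasCompactSupport ?_
  refine HasCompactSupport.intro (isCompact_Icc : IsCompact (Icc (-2 : ℝ) 2)) fun x hx => ?_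
  have : 2 * (1 : ℝ) ≤ |x| := by
    simp only [mem_Icc, not_and_or, not_le] at hx
    rcases hx with hx | hx
    · linarith [neg_abs_le x]
    · linarith [le_abs_self x]
  exact (cutoff_and_deriv_eq_zero one_pos this).1

/-- **The unit cutoff has mass at least `2`** (it equals `1` on `[-1, 1]`); in particular its mass is positive. [folklore] -/
theorem two_le_integral_cutoff_one : 2 ≤ ∫ y, cutoff 1 y := by
  have hind : ∫ y, (Icc (-1 : ℝ) 1).indicator (fun _ => (1 : ℝ)) y = 2 := by
    rw [integral_indicator measurableSet_Icc, setIntegral_const, smul_eq_mul, mul_one, Real.volume_real_Icc]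
    norm_num
  rw [← hind]
  have hIon : IntegrableOn (fun _ => (1 : ℝ)) (Icc (-1 : ℝ) 1) volume :=
    integrableOn_const (by rw [Real.volume_Icc]; exact ENNReal.ofReal_ne_top)
  have hI : Integrable ((Icc (-1 : ℝ) 1).indicator fun _ => (1 : ℝ)) := hIon.integrable_indicator measurableSet_Icc
  refine integral_mono hI integrable_cutoff_one fun y => ?_
  by_cases hy : y ∈ Icc (-1 : ℝ) 1
  · rw [indicator_of_mem hy]
    have : y ^ 2 ≤ 1 ^ 2 := by
      rw [mem_Icc] at hy
      nlinarith [hy.1, hy.2]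
    exact (cutoff_eq_one one_pos this).symm.le
  · rw [indicator_of_notMem hy]
    exact (cutoff_nonneg_le_one 1 y).1

/-- The mass of the unit cutoff is positive. [folklore] -/
theorem integral_cutoff_one_pos : 0 < ∫ y, cutoff 1 y := lt_of_lt_of_le (by norm_num) two_le_integral_cutoff_one

/-- **The normalised even bump** `ρ = χ₁ / ∫χ₁`. [folklore] -/
def bumpFun (ξ : ℝ) : ℝ := cutoff 1 ξ / ∫ y, cutoff 1 y

/-- Its derivative `ρ₁ = χ₁′ / ∫χ₁`. [folklore] -/
def bumpDeriv (ξ : ℝ) : ℝ := deriv (cutoff 1) ξ / ∫ y, cutoff 1 y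

/-- **The bump is an even test.** [folklore] -/
theorem isCompactTestE_bump : IsCompactTestE bumpFun bumpDeriv := by
  have hχ := contDiff_cutoff 1
  set M : ℝ := ∫ y, cutoff 1 y with hM
  have hM0 : 0 < M := integral_cutoff_one_pos
  refine ⟨⟨fun x => ?_, ?_, ⟨2, fun x hx => ?_⟩⟩, fun y => ?_⟩
  · -- primitive form from the product rule with `u ≡ 1`
    have h := primitive_mul (χ := cutoff 1) (u := fun _ => (1 : ℝ)) (u₁ := fun _ => (0 : ℝ)) hχ
      (fun x => by simp) MemLp.zero x
    simp only [mul_one, mul_zero, add_zero] at h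
    show cutoff 1 x / M = cutoff 1 0 / M + ∫ s in (0 : ℝ)..x, deriv (cutoff 1) s / M
    rw [intervalIntegral.integral_div, h, add_div]
  · show MemLp (fun ξ => deriv (cutoff 1) ξ / M) 2 volume
    have hc : Continuous (deriv (cutoff 1)) := (hasDerivAt_cutoff 1 0).2
    have hsupp : HasCompactSupport (deriv (cutoff 1)) := by
      refine HasCompactSupport.intro (isCompact_Icc : IsCompact (Icc (-2 : ℝ) 2)) fun x hx => ?_
      have : 2 * (1 : ℝ) ≤ |x| := by
        simp only [mem_Icc, not_and_or, not_le] at hx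
        rcases hx with hx | hx
        · linarith [neg_abs_le x]
        · linarith [le_abs_self x]
      exact (cutoff_and_deriv_eq_zero one_pos this).2
    have hm : MemLp (deriv (cutoff 1)) 2 volume := hc.memLp_of_hasCompactSupport hsupp
    have e : (fun ξ => deriv (cutoff 1) ξ / M) = fun ξ => deriv (cutoff 1) ξ * M⁻¹ := by
      funext ξ; rw [div_eq_mul_inv]
    rw [e]
    exact hm.mul_const _
  · have h2 : 2 * (1 : ℝ) ≤ |x| := by linarith
    obtain ⟨h1, h2⟩ := cutoff_and_deriv_eq_zero one_pos h2
    simp [bumpFun, bumpDeriv, h1, h2]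
  · simp only [bumpFun, cutoff_neg]

/-- **The bump has mass one.** [folklore] -/
theorem integral_bumpFun : ∫ y, bumpFun y = 1 := by
  simp only [bumpFun]
  rw [integral_div, div_self integral_cutoff_one_pos.ne']

/-- The bump pair as an element of `testSpaceE`. [folklore] -/
def bump : testSpaceE := ⟨(bumpFun, bumpDeriv), isCompactTestE_bump⟩

/-- **Codimension-one decomposition.** For every even test `(v, v₁)`: `(v, v₁) − (∫v)·ρ ∈ testSpaceE0`. [folklore] -/
theorem sub_mass_smul_bump_mem (vp : testSpaceE) :
    ((vp : (ℝ → ℝ) × (ℝ → ℝ)) - (∫ y, vp.1.1 y) • ((bumpFun, bumpDeriv) : (ℝ → ℝ) × (ℝ → ℝ))) ∈ testSpaceE0 := by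
  have hb : ((bumpFun, bumpDeriv) : (ℝ → ℝ) × (ℝ → ℝ)) ∈ testSpaceE := isCompactTestE_bump
  have hmem : ((vp : (ℝ → ℝ) × (ℝ → ℝ)) - (∫ y, vp.1.1 y) • ((bumpFun, bumpDeriv) : (ℝ → ℝ) × (ℝ → ℝ))) ∈ testSpaceE :=
    testSpaceE.sub_mem vp.2 (testSpaceE.smul_mem _ hb)
  refine ⟨hmem, ?_⟩
  have hsm : IsCompactTestE ((∫ y, vp.1.1 y) • bumpFun) ((∫ y, vp.1.1 y) • bumpDeriv) := isCompactTestE_smul _ isCompactTestE_bump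
  rw [Prod.fst_sub, Prod.smul_fst]
  simp only [Pi.sub_apply, Pi.smul_apply, smul_eq_mul]
  rw [integral_sub (memLp_integrable_of_any vp.2.toIsCompactTestAny).2
    ((memLp_integrable_of_any isCompactTestE_bump.toIsCompactTestAny).2.const_mul _), integral_const_mul, integral_bumpFun,
    mul_one, sub_self]

/-- **Defect-constant device.** A real function on even tests that is additive and homogeneous (on `testSpaceE`) and VANISHES on the
zero-mass tests is `c·(mass)` with `c` = its value at the bump. [folklore] -/
theorem eq_mass_mul_of_vanishes (Λ : testSpaceE →ₗ[ℝ] ℝ)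
    (hΛ : ∀ vp : testSpaceE, ∫ y, vp.1.1 y = 0 → Λ vp = 0) (vp : testSpaceE) :
    Λ vp = (∫ y, vp.1.1 y) * Λ bump := by
  have hmem := sub_mass_smul_bump_mem vp
  set wq : testSpaceE := vp - (∫ y, vp.1.1 y) • bump with hwq
  have hw0 : ∫ y, wq.1.1 y = 0 := hmem.2
  have h := hΛ wq hw0
  rw [hwq, map_sub, map_smul, smul_eq_mul] at h
  linarith

/-! ### §5 The cutoff tests of an EVEN profile -/

/-- **`χ_R u` is an even test** for `u` even in primitive form with `u, u₁ ∈ L²` (`R > 0`), and it vanishes where `2R ≤ |ξ|`. [folklore] -/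
theorem isCompactTestE_cutoff_mul {u u₁ : ℝ → ℝ} {R : ℝ} (hR : 0 < R) (hu : ∀ x, u x = u 0 + ∫ s in (0 : ℝ)..x, u₁ s)
    (heven : ∀ y, u (-y) = u y) (hu₁ : MemLp u₁ 2 volume) (hu2 : MemLp u 2 volume) :
    IsCompactTestE (fun ξ => cutoff R ξ * u ξ) (fun ξ => deriv (cutoff R) ξ * u ξ + cutoff R ξ * u₁ ξ) ∧
      ∀ x, 2 * R ≤ |x| → cutoff R x * u x = 0 ∧ deriv (cutoff R) x * u x + cutoff R x * u₁ x = 0 := by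
  obtain ⟨M, hM0, hM⟩ := exists_deriv_cutoff_le
  have hχc : Continuous (cutoff R) := (contDiff_cutoff R).continuous
  have hχ'c : Continuous (deriv (cutoff R)) := (hasDerivAt_cutoff R 0).2
  have hii : ∀ a b, IntervalIntegrable u₁ volume a b := intervalIntegrable_of_memLp_two hu₁
  have huc : Continuous u := continuous_of_primitive hu hii
  have hsupp : ∀ x, 2 * R ≤ |x| → cutoff R x * u x = 0 ∧ deriv (cutoff R) x * u x + cutoff R x * u₁ x = 0 := by
    intro x hx
    obtain ⟨h1, h2⟩ := cutoff_and_deriv_eq_zero hR hx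
    simp [h1, h2]
  refine ⟨⟨⟨fun x => ?_, ?_, ⟨2 * R, hsupp⟩⟩, fun y => ?_⟩, hsupp⟩
  · have h := primitive_mul (contDiff_cutoff R) hu hu₁ x
    simpa using h
  · have hm : AEStronglyMeasurable (fun ξ => deriv (cutoff R) ξ * u ξ + cutoff R ξ * u₁ ξ) volume :=
      (hχ'c.aestronglyMeasurable.mul huc.aestronglyMeasurable).add (hχc.aestronglyMeasurable.mul hu₁.1)
    rw [memLp_two_iff_integrable_sq hm]
    refine (((hu2.integrable_sq.const_mul ((M / R) ^ 2)).add hu₁.integrable_sq).const_mul 2).mono' (hm.pow 2)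
      (Eventually.of_forall fun ξ => ?_)
    rw [Real.norm_eq_abs, abs_of_nonneg (sq_nonneg _)]
    simp only [Pi.add_apply]
    have h1 : (deriv (cutoff R) ξ * u ξ) ^ 2 ≤ (M / R) ^ 2 * u ξ ^ 2 := by
      rw [mul_pow, ← sq_abs (deriv (cutoff R) ξ)]
      exact mul_le_mul_of_nonneg_right (pow_le_pow_left₀ (abs_nonneg _) (hM R hR ξ) 2) (sq_nonneg _)
    have h2 : (cutoff R ξ * u₁ ξ) ^ 2 ≤ u₁ ξ ^ 2 := by
      rw [mul_pow]
      obtain ⟨h0, h1'⟩ := cutoff_nonneg_le_one R ξ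
      have : cutoff R ξ ^ 2 ≤ 1 := by nlinarith
      nlinarith [sq_nonneg (u₁ ξ)]
    nlinarith [sq_nonneg (deriv (cutoff R) ξ * u ξ - cutoff R ξ * u₁ ξ)]
  · simp only [cutoff_neg, heven]

/-- The cutoff of an even profile is again in the (even, `L²`) class: `χ_R u ∈ L²` and `χ_R′u + χ_R u₁ ∈ L²`. [folklore] -/
theorem memLp_cutoff_mulE {u u₁ : ℝ → ℝ} {R : ℝ} (hR : 0 < R) (hu : ∀ x, u x = u 0 + ∫ s in (0 : ℝ)..x, u₁ s)
    (heven : ∀ y, u (-y) = u y) (hu₁ : MemLp u₁ 2 volume) (hu2 : MemLp u 2 volume) :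
    MemLp (fun ξ => cutoff R ξ * u ξ) 2 volume ∧ MemLp (fun ξ => deriv (cutoff R) ξ * u ξ + cutoff R ξ * u₁ ξ) 2 volume := by
  refine ⟨?_, (isCompactTestE_cutoff_mul hR hu heven hu₁ hu2).1.memLp⟩
  have hχc : Continuous (cutoff R) := (contDiff_cutoff R).continuous
  have hm : AEStronglyMeasurable (fun ξ => cutoff R ξ * u ξ) volume := hχc.aestronglyMeasurable.mul hu2.1
  rw [memLp_two_iff_integrable_sq hm]
  refine hu2.integrable_sq.mono' (hm.pow 2) (Eventually.of_forall fun ξ => ?_)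
  rw [Real.norm_eq_abs, abs_of_nonneg (sq_nonneg _), mul_pow]
  obtain ⟨h0, h1⟩ := cutoff_nonneg_le_one R ξ
  have : cutoff R ξ ^ 2 ≤ 1 := by nlinarith
  nlinarith [sq_nonneg (u ξ)]

/-- **`χ_R² u` is an even test** (`R > 0`). [folklore] -/
theorem isCompactTestE_cutoff_sq_mul {u u₁ : ℝ → ℝ} {R : ℝ} (hR : 0 < R) (hu : ∀ x, u x = u 0 + ∫ s in (0 : ℝ)..x, u₁ s)
    (heven : ∀ y, u (-y) = u y) (hu₁ : MemLp u₁ 2 volume) (hu2 : MemLp u 2 volume) :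
    IsCompactTestE (fun ξ => cutoff R ξ * (cutoff R ξ * u ξ))
      (fun ξ => deriv (cutoff R) ξ * (cutoff R ξ * u ξ) + cutoff R ξ * (deriv (cutoff R) ξ * u ξ + cutoff R ξ * u₁ ξ)) := by
  obtain ⟨hv, -⟩ := isCompactTestE_cutoff_mul hR hu heven hu₁ hu2
  obtain ⟨hv2, hv₁2⟩ := memLp_cutoff_mulE hR hu heven hu₁ hu2
  have hv0 : ∀ x, cutoff R x * u x = cutoff R 0 * u 0 + ∫ s in (0 : ℝ)..x, (deriv (cutoff R) s * u s + cutoff R s * u₁ s) := by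
    intro x
    have h := hv.primitive x
    simpa using h
  exact (isCompactTestE_cutoff_mul (u := fun ξ => cutoff R ξ * u ξ)
    (u₁ := fun ξ => deriv (cutoff R) ξ * u ξ + cutoff R ξ * u₁ ξ) hR hv0 hv.even hv₁2 hv2).1

/-! ### §6 Masses of the cutoffs of an integrable profile tend to the mass -/

/-- **`∫ χ_{n+1} u → ∫ u`** for `u ∈ L¹` (dominated convergence: `|χ_R u| ≤ |u|`, `χ_R(ξ) = 1` once `R² ≥ ξ²`). [folklore] -/
theorem tendsto_integral_cutoff_mul {u : ℝ → ℝ} (hu : Integrable u) :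
    Tendsto (fun n : ℕ => ∫ y, cutoff ((n : ℝ) + 1) y * u y) atTop (𝓝 (∫ y, u y)) := by
  refine tendsto_integral_of_dominated_convergence (fun y => |u y|) (fun n => ?_) hu.abs (fun n => ?_) ?_
  · exact ((contDiff_cutoff _).continuous.aestronglyMeasurable).mul hu.1
  · refine Eventually.of_forall fun y => ?_
    rw [Real.norm_eq_abs, abs_mul]
    obtain ⟨h0, h1⟩ := cutoff_nonneg_le_one ((n : ℝ) + 1) y
    rw [abs_of_nonneg h0]
    nlinarith [abs_nonneg (u y)]
  · refine Eventually.of_forall fun y => ?_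
    have hev : ∀ᶠ n : ℕ in atTop, cutoff ((n : ℝ) + 1) y * u y = u y := by
      obtain ⟨N, hN⟩ := exists_nat_gt |y|
      filter_upwards [eventually_ge_atTop N] with n hn
      have hn' : (N : ℝ) ≤ n := by exact_mod_cast hn
      have hy : y ^ 2 ≤ ((n : ℝ) + 1) ^ 2 := by
        rw [← sq_abs y]
        exact pow_le_pow_left₀ (abs_nonneg _) (by linarith) 2
      rw [cutoff_eq_one (by positivity) hy, one_mul]
    exact tendsto_const_nhds.congr' (hev.mono fun n hn => hn.symm)

/-- **`∫ χ_{n+1}² u → ∫ u`** for `u ∈ L¹`. [folklore] -/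
theorem tendsto_integral_cutoff_sq_mul {u : ℝ → ℝ} (hu : Integrable u) :
    Tendsto (fun n : ℕ => ∫ y, cutoff ((n : ℝ) + 1) y * (cutoff ((n : ℝ) + 1) y * u y)) atTop (𝓝 (∫ y, u y)) := by
  refine tendsto_integral_of_dominated_convergence (fun y => |u y|) (fun n => ?_) hu.abs (fun n => ?_) ?_
  · exact ((contDiff_cutoff _).continuous.aestronglyMeasurable).mul
      (((contDiff_cutoff _).continuous.aestronglyMeasurable).mul hu.1)
  · refine Eventually.of_forall fun y => ?_
    rw [Real.norm_eq_abs, abs_mul, abs_mul]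
    obtain ⟨h0, h1⟩ := cutoff_nonneg_le_one ((n : ℝ) + 1) y
    rw [abs_of_nonneg h0]
    have : cutoff ((n : ℝ) + 1) y * (cutoff ((n : ℝ) + 1) y * |u y|) ≤ 1 * (1 * |u y|) := by
      gcongr
    linarith
  · refine Eventually.of_forall fun y => ?_
    have hev : ∀ᶠ n : ℕ in atTop, cutoff ((n : ℝ) + 1) y * (cutoff ((n : ℝ) + 1) y * u y) = u y := by
      obtain ⟨N, hN⟩ := exists_nat_gt |y|
      filter_upwards [eventually_ge_atTop N] with n hn
      have hn' : (N : ℝ) ≤ n := by exact_mod_cast hn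
      have hy : y ^ 2 ≤ ((n : ℝ) + 1) ^ 2 := by
        rw [← sq_abs y]
        exact pow_le_pow_left₀ (abs_nonneg _) (by linarith) 2
      rw [cutoff_eq_one (by positivity) hy, one_mul, one_mul]
    exact tendsto_const_nhds.congr' (hev.mono fun n hn => hn.symm)

end SheetREvenTests
end Summit.NavierStokesRegularity.OSWSelfSimilar

end
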